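import Summits.NavierStokesRegularity.FluidComputer.GateBudgetRungFine
import Summits.NavierStokesRegularity.FluidComputer.GateBudgetRungTwoSided
import Summits.NavierStokesRegularity.FluidComputer.GateBudgetDriftFine
import Summits.NavierStokesRegularity.FluidComputer.GateBudgetColdDamping
import HarnessLib

/-!
# GateBudget part 80 — the ledger rung: one clean misfire with all four ledgers (§235–§236)

Cell `pub-fluidc`, blueprint seat bp1 (gen 36, seventh item: THE d-LEDGER III, SPEC-INPUT-bp1
§BK(4)); namespace `Summit.NavierStokesRegularity.FluidComputer.GateBudget`, headline member
`RotorKnob.rotorCircuit K K¹⁰ ε ρ` of the two-scale family from `delayInit` (5.6), `K ≥ 16`, on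
the lattice window `200ε/K²⁰ ≤ ρ² ≤ 2ε/K¹⁰`, `ε² ≤ 1/(6K²⁰)`, `ε = kK¹⁰ρ²`; modes `0 = a`
(carrier), `1 = b` (clock), `2 = c` (trigger), `3 = d` (transfer), `4 = ã` (output).
HONEST FRAMING: a low prior, high value-of-information experiment on Tao's machine paradigm;
NOT a claim that NS blows up.

WHAT. Part 66 §207 `knob_rung_succ_fine` maps a budgeted normal-form ignition `r` (`b(r) =
θε`, `5/4 ≤ θ ≤ 29/20`, `c(r) = ρ²/K⁹`, pair budget) to its pulse exit `T'`, the cold phase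
`[T', r']` and the next ignition `r'`, existentially. §236 `knob_rung_ledger` re-exports that
map VERBATIM and attaches, at the SAME `T'` and `r'`, the four ledgers of one clean rung:
OUTPUT across the pulse, two-sided, `ã(r) + 1/K⁹ ≤ ã(T') ≤ ã(r) + (7/2 + k²/3 + (2 log k +
520 log K)·d(r)²)/K⁹` (parts 71/75 as in part 76 §227); TRANSFER across the pulse, `|d(T')| ≤
|d(r)| + (5k + (k/2 + 4)·Kã(T'))/K¹⁰` (part 79 §234 with §235's numerics); TRANSFER across
the cold phase, `r' - T' ≥ 9/4` and `|d(r')| ≤ |d(T')|·e^{-(9/4)Kã(T')} + 3/K⁹` (part 77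
§229); OUTPUT across the cold phase, `ã(T') ≤ ã(r') ≤ ã(T') + 3K(|d(T')| + 3/K⁹)²` (§235
`cold_output_growth`: `ã' = Kd²` with part 77's pointwise cold bound on `d`).
HOW. Every hypothesis the pulse laws need at part 66's `T'` is among part 66's CONCLUSIONS
(live trigger, exit clock `b(T') = -θ₁ε` with `θ₁ ≥ θ - 243/K⁹ ≥ (31/32)θ`, the misfire pin,
the two pulse lengths) except the kept ring, which part 53's horizon-free radius law
`knob_radius_kept_free` supplies on any window of length `≤ 242/K⁹` entered at radius `≤ 2ε`;
so nothing of part 66's proof is reopened. §235 `ledger_numerics` is pure real analysis: with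
the pin `δ ≤ 4k/K¹⁰`, `2ε² + ρ²e^{-K¹⁰} ≤ 1/50` and `968/K⁹ ≤ 1/100` it turns §234's bound
`δ + (2ε² + ρ²e^{-K¹⁰} + x)·((0.45k + 3.4)/K¹⁰ + 242δ/K⁹)` into `(5k + (k/2 + 4)x)/K¹⁰`.
READING (SPEC-INPUT-bp1 §BK(3)). Along the clean ladder this is the one-step law of the
d-ledger, `d_{n+1} ≤ e^{-(9/4)x_n}·(d_n + (5k + (k/2 + 4)x_n)/K¹⁰) + 3/K⁹`, `x_n = Kã(T'_n)`,
whose injection is `O((k + 4)/K⁹)` uniformly in the output level (`x·e^{-(9/4)x} ≤ 4/(9e)`),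
together with the output ledger INCLUDING the cold phase (where `d² + ã²` is transferred, not
created: the growth is quadratic in the transfer mode). The summation along the ladder and
the two-sided dud horizon are NOT here (parts 81/82).
HONEST LIMITS. (i) `∃ T' θ₁ tz r' θ'` exactly as part 66 — the ledgers hold at THAT exit and
THAT relight, no uniqueness is claimed; (ii) the hypotheses are part 66's, in particular the
pair budget `P(r) + 0.3η′ + 6/K⁹ ≤ 1/50` and `θ ≤ 29/20` — discharging them along the
ladder from the ledgers (instead of part 66's pair slip) is part 82's job; (iii) constants are
generous (`5k` where `≈ 2.1k + 0.1` would do, `k/2 + 4` for `0.46k + 3.4`, the cold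
forcing `3/K⁹` is the crude one of part 77); (iv) nothing about Navier–Stokes.
[cite: Tao2016AveragedNS, §5.5 Theorem 5.3, (5.5), (5.6), (b-eq), (c-eq), (d-eq), (ta-eq),
(energy-con), (est)]
-/

noncomputable section

namespace Summit.NavierStokesRegularity.FluidComputer.GateBudget

open Real Set Filter Topology
open Literature.Analysis.FluidPDE.Tao2016AveragedNS

variable {K ε ρ : ℝ} {X : ℝ → Fin 5 → ℝ} {C : ℝ → ℝ}

/-! ## §235 Numerics of the transfer injection; the cold phase's output growth -/

/-- §235 NUMERICS (`K ≥ 16`, `ε² ≤ 1/(6K²⁰)`, `K¹⁰ρ² ≤ 2ε`, `k ≥ 1`, pin `0 ≤ δ ≤ 4k/K¹⁰`,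
`x ≥ 0`): `δ + (2ε² + ρ²e^{-K¹⁰} + x)((0.45k + 3.4)/K¹⁰ + 242δ/K⁹) ≤ (5k + (k/2 + 4)x)/K¹⁰`.
[folklore] -/
theorem ledger_numerics (hK : 16 ≤ K) (hεK : ε ^ 2 ≤ 1 / (6 * K ^ 20))
    (hhi : K ^ 10 * ρ ^ 2 ≤ 2 * ε) {k δ x : ℝ} (hk1 : 1 ≤ k) (hδ0 : 0 ≤ δ)
    (hδk : δ ≤ 4 * k / K ^ 10) (hx : 0 ≤ x) :
    δ + (2 * ε ^ 2 + ρ ^ 2 * exp (-K ^ 10) + x) * ((0.45 * k + 3.4) / K ^ 10 + 242 * δ / K ^ 9)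
      ≤ (5 * k + (k / 2 + 4) * x) / K ^ 10 := by
  have hK0 : (0 : ℝ) < K := by linarith
  have hK9 : (0 : ℝ) < K ^ 9 := by positivity
  have hK10 : (0 : ℝ) < K ^ 10 := by positivity
  have h169 : (16 : ℝ) ^ 9 ≤ K ^ 9 := pow_le_pow_left₀ (by norm_num) hK 9
  have h1610 : (16 : ℝ) ^ 10 ≤ K ^ 10 := pow_le_pow_left₀ (by norm_num) hK 10
  have h1620 : (16 : ℝ) ^ 20 ≤ K ^ 20 := pow_le_pow_left₀ (by norm_num) hK 20
  -- the pin part of the weight is below `k/(100K¹⁰)`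
  have e1 : 242 * δ / K ^ 9 ≤ 242 * (4 * k / K ^ 10) / K ^ 9 :=
    div_le_div_of_nonneg_right (mul_le_mul_of_nonneg_left hδk (by norm_num)) hK9.le
  have e2 : 242 * (4 * k / K ^ 10) / K ^ 9 ≤ k / 100 / K ^ 10 := by
    have e : 242 * (4 * k / K ^ 10) / K ^ 9 = 968 * k / (K ^ 10 * K ^ 9) := by
      field_simp
      ring
    rw [e, div_le_div_iff₀ (by positivity) hK10]
    have hkK : (0 : ℝ) ≤ k * K ^ 10 := by positivity
    nlinarith only [mul_le_mul_of_nonneg_left h169 hkK, hkK]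
  have hw : (0.45 * k + 3.4) / K ^ 10 + 242 * δ / K ^ 9 ≤ (0.46 * k + 3.4) / K ^ 10 := by
    have e3 : (0.45 * k + 3.4) / K ^ 10 + k / 100 / K ^ 10 = (0.46 * k + 3.4) / K ^ 10 := by
      rw [← add_div]
      congr 1
      ring
    linarith only [e1, e2, e3]
  have hw0 : 0 ≤ (0.45 * k + 3.4) / K ^ 10 + 242 * δ / K ^ 9 :=
    add_nonneg (div_nonneg (by linarith only [hk1]) hK10.le)
      (div_nonneg (mul_nonneg (by norm_num) hδ0) hK9.le)
  -- the prefactor `2ε² + σ` is below `1/50`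
  have hε1 : ε ^ 2 ≤ 1 :=
    hεK.trans (by rw [div_le_one (by positivity)]; nlinarith only [h1620])
  have hε1' : ε ≤ 1 := by nlinarith only [hε1]
  have e4 : 2 * ε ^ 2 ≤ 2 * (1 / (6 * 16 ^ 20)) :=
    mul_le_mul_of_nonneg_left (hεK.trans (div_le_div_of_nonneg_left (by norm_num)
      (by positivity) (by nlinarith only [h1620]))) (by norm_num)
  have e5 : ρ ^ 2 * exp (-K ^ 10) ≤ ρ ^ 2 :=
    mul_le_of_le_one_right (sq_nonneg ρ) (exp_le_one_iff.2 (neg_nonpos.2 hK10.le))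
  have e6 : ρ ^ 2 ≤ 2 * ε / K ^ 10 := by
    rw [le_div_iff₀ hK10]
    linarith only [hhi]
  have e7 : 2 * ε / K ^ 10 ≤ 2 / 16 ^ 10 := by
    rw [div_le_div_iff₀ hK10 (by norm_num)]
    nlinarith only [hε1', h1610]
  have hS : 2 * ε ^ 2 + ρ ^ 2 * exp (-K ^ 10) ≤ 1 / 50 := by
    have : 2 * (1 / (6 * (16 : ℝ) ^ 20)) + 2 / 16 ^ 10 ≤ 1 / 50 := by norm_num
    linarith only [e4, e5, e6, e7, this]
  -- assemble
  have key : (2 * ε ^ 2 + ρ ^ 2 * exp (-K ^ 10) + x)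
      * ((0.45 * k + 3.4) / K ^ 10 + 242 * δ / K ^ 9)
      ≤ (1 / 50 + x) * ((0.46 * k + 3.4) / K ^ 10) :=
    mul_le_mul (by linarith only [hS]) hw hw0 (by linarith only [hx])
  have h1 : 1 / K ^ 10 ≤ k / K ^ 10 := div_le_div_of_nonneg_right hk1 hK10.le
  have h2 : 0 ≤ x * k / K ^ 10 := by positivity
  have h3 : 0 ≤ x / K ^ 10 := by positivity
  have expand : (1 / 50 + x) * ((0.46 * k + 3.4) / K ^ 10)
      = 0.0092 * (k / K ^ 10) + 0.068 * (1 / K ^ 10) + 0.46 * (x * k / K ^ 10)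
        + 3.4 * (x / K ^ 10) := by
    field_simp
    ring
  have target : (5 * k + (k / 2 + 4) * x) / K ^ 10
      = 5 * (k / K ^ 10) + (1 / 2) * (x * k / K ^ 10) + 4 * (x / K ^ 10) := by
    field_simp
    ring
  have hδk' : δ ≤ 4 * (k / K ^ 10) := by rw [mul_div_assoc] at hδk; exact hδk
  have h0 : 0 ≤ 1 / K ^ 10 := by positivity
  rw [target]
  linarith only [hδk', key, expand, h0, h1, h2, h3]

/-- §235 **THE COLD PHASE'S OUTPUT GROWTH** (headline member, `K ≥ 16`): on a cold phase
`[T, r]` (`T ≥ 0`, `r ≤ T + 3`, `c ≤ ρ²/K⁹` on it) `ã(r) ≤ ã(T) + 3K(|d(T)| + 3/K⁹)²` — since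
`ã' = Kd²` and `|d| ≤ |d(T)| + 3/K⁹` there (part 77 §229 pointwise, `e^{-…} ≤ 1`).
[derived: part 77 §229; Tao2016AveragedNS (ta-eq)] -/
theorem cold_output_growth
    (hX : ∀ t, HasDerivAt X (RotorKnob.rotorCircuit K (K ^ 10) ε ρ (X t)) t)
    (h0 : X 0 = delayInit) (hK : 16 ≤ K) {T r : ℝ} (hT : 0 ≤ T) (hTr : T ≤ r)
    (hr3 : r ≤ T + 3) (hc : ∀ t ∈ Icc T r, X t 2 ≤ ρ ^ 2 / K ^ 9) (hρ : 0 < ρ) :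
    X r 4 ≤ X T 4 + 3 * K * (|X T 3| + 3 / K ^ 9) ^ 2 := by
  have hK0 : (0 : ℝ) ≤ K := by linarith
  obtain ⟨D, hD⟩ : ∃ D : ℝ, D = |X T 3| + 3 / K ^ 9 := ⟨_, rfl⟩
  have hDt : ∀ t ∈ Icc T r, X t 3 ^ 2 ≤ D ^ 2 := by
    intro t ht
    have h := knob_cold_transfer hX h0 hK hT ht.1 (by linarith only [ht.2, hr3])
      (fun s hs => hc s ⟨hs.1, hs.2.trans ht.2⟩) hρ
    have hx : 0 ≤ K * X T 4 * (t - T) :=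
      mul_nonneg (mul_nonneg hK0 (RotorKnob.e_nonneg hX h0 hK0 hT)) (sub_nonneg.2 ht.1)
    have h1 : |X T 3| * exp (-(K * X T 4 * (t - T))) ≤ |X T 3| :=
      mul_le_of_le_one_right (abs_nonneg _) (exp_le_one_iff.2 (by linarith only [hx]))
    have h2 : |X t 3| ≤ D := by rw [hD]; linarith only [h, h1]
    have h3 := pow_le_pow_left₀ (abs_nonneg _) h2 2
    rwa [sq_abs] at h3
  have hmono := Thm53.antitoneOn_sub_of_deriv_le (f := fun s => X s 4)
    (f' := fun s => K * X s 3 ^ 2) (Φ := fun s => K * D ^ 2 * s) (φ := fun _ => K * D ^ 2)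
    (convex_Icc T r) (fun s _ => RotorKnob.hasDerivAt_e hX s)
    (fun s _ => ((hasDerivAt_id' s).const_mul (K * D ^ 2)).congr_deriv (mul_one _))
    (fun s hs => mul_le_mul_of_nonneg_left (hDt s hs) hK0)
  have h := hmono (left_mem_Icc.2 hTr) (right_mem_Icc.2 hTr) hTr
  dsimp only at h
  have h3 : K * D ^ 2 * (r - T) ≤ K * D ^ 2 * 3 :=
    mul_le_mul_of_nonneg_left (by linarith only [hr3]) (by positivity)
  rw [← hD]
  linarith only [h, h3]

/-! ## §236 The ledger rung -/

/-- §236 **THE LEDGER RUNG** (headline member from `delayInit` with a trigger primitive `C`,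
`K ≥ 16`, `0 < ε`, `ε² ≤ 1/(6K²⁰)`, `0 < ρ`, `200ε/K²⁰ ≤ ρ²`, `K¹⁰ρ² ≤ 2ε`, `ε = kK¹⁰ρ²`; a
budgeted normal-form ignition exactly as part 66 §207: `r ≥ 0`, `b(r) = θε`, `5/4 ≤ θ ≤
29/20`, `c(r) = ρ²/K⁹`, `P(r) + 0.3η′ + 6/K⁹ ≤ 1/50`). THEN part 66 §207's conclusion holds
verbatim for some `T' θ₁ tz r' θ'` AND, at the same `T'`, `r'`: `ã(r) + 1/K⁹ ≤ ã(T') ≤ ã(r)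
+ (7/2 + k²/3 + (2 log k + 520 log K)·d(r)²)/K⁹`, `|d(T')| ≤ |d(r)| + (5k + (k/2 +
4)·Kã(T'))/K¹⁰`, `r' - T' ≥ 9/4`, `|d(r')| ≤ |d(T')|e^{-(9/4)Kã(T')} + 3/K⁹`, `ã(T') ≤ ã(r')
≤ ã(T') + 3K(|d(T')| + 3/K⁹)²`. [derived: part 66 §207, part 53 `knob_radius_kept_free`,
part 71 §217, part 75 §226, part 79 §234, part 77 §229, §235] -/
theorem knob_rung_ledger
    (hX : ∀ t, HasDerivAt X (RotorKnob.rotorCircuit K (K ^ 10) ε ρ (X t)) t)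
    (h0 : X 0 = delayInit) (hC : ∀ t, HasDerivAt C (X t 2) t) (hK : 16 ≤ K)
    (hε : 0 < ε) (hεK : ε ^ 2 ≤ 1 / (6 * K ^ 20)) (hρ : 0 < ρ)
    (hlo : 200 * ε / K ^ 20 ≤ ρ ^ 2) (hhi : K ^ 10 * ρ ^ 2 ≤ 2 * ε) (k : ℕ)
    (hk : ε = k * K ^ 10 * ρ ^ 2) {r θ : ℝ} (hr : 0 ≤ r) (hθ1 : 5 / 4 ≤ θ)
    (hθ2 : θ ≤ 29 / 20) (hbr : X r 1 = θ * ε) (hcr : X r 2 = ρ ^ 2 / K ^ 9)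
    (hPr : X r 3 ^ 2 + X r 4 ^ 2
      + 3 * (k * π / ((25 / 16 - 1 / 10 ^ 6) * K ^ 10 - 1) + 1 / K ^ 19
        + 310 * log K / K ^ 9) / 10 + 6 / K ^ 9 ≤ 1 / 50) :
    ∃ T' θ₁ tz r' θ' : ℝ,
      (r < T' ∧ T' - r ≤ 242 / K ^ 9 ∧ T' - r ≤ 241 * log K / K ^ 10 ∧
        (∀ t ∈ Icc r T', 0 < X t 2) ∧ X T' 1 = -(θ₁ * ε) ∧
        θ - 243 / K ^ 9 ≤ θ₁ ∧ θ₁ ≤ θ + 243 / K ^ 9 ∧ X T' 2 ≤ 2 * ρ ^ 2 / K ^ 10 ∧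
        |(C T' - C r) / ρ ^ 2 - k * π|
          ≤ k * π / ((25 / 16 - 1 / 10 ^ 6) * K ^ 10 - 1) + 1 / K ^ 19 ∧
        0 ≤ X T' 4 ∧ X T' 4 ≤ X r 4 + K * (241 * log K / K ^ 10)) ∧
      (T' + 1 ≤ tz ∧ X tz 1 = 0 ∧ tz < r' ∧ r' < T' + 3 ∧
        (∀ t ∈ Icc T' r', X t 2 ≤ ρ ^ 2 / K ^ 9) ∧ X r' 2 = ρ ^ 2 / K ^ 9) ∧
      (X r' 1 = θ' * ε ∧ θ' ≤ 141422 / 100000 ∧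
        (θ - 286 / K ^ 9 ≤ θ' ∨ 139999 / 100000 ≤ θ') ∧
        X r' 3 ^ 2 + X r' 4 ^ 2 ≤ X r 3 ^ 2 + X r 4 ^ 2
          + 3 * (k * π / ((25 / 16 - 1 / 10 ^ 6) * K ^ 10 - 1) + 1 / K ^ 19
            + 310 * log K / K ^ 9) / 10 + 6 / K ^ 9 ∧
        r + 1 ≤ r') ∧
      (X r 4 + 1 / K ^ 9 ≤ X T' 4 ∧
        X T' 4 ≤ X r 4 + (7 / 2 + k ^ 2 / 3 + (2 * log k + 520 * log K) * X r 3 ^ 2) / K ^ 9 ∧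
        |X T' 3| ≤ |X r 3| + (5 * k + (k / 2 + 4) * (K * X T' 4)) / K ^ 10 ∧
        9 / 4 ≤ r' - T' ∧
        |X r' 3| ≤ |X T' 3| * exp (-(9 / 4 * (K * X T' 4))) + 3 / K ^ 9 ∧
        X T' 4 ≤ X r' 4 ∧ X r' 4 ≤ X T' 4 + 3 * K * (|X T' 3| + 3 / K ^ 9) ^ 2) := by
  have hK0 : (0 : ℝ) < K := by linarith
  have hK1 : (1 : ℝ) ≤ K := by linarith
  have hK9pos : (0 : ℝ) < K ^ 9 := by positivity
  have hK10pos : (0 : ℝ) < K ^ 10 := by positivity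
  have hlogK : 0 ≤ log K := log_nonneg hK1
  have hθ2' : θ ≤ 3 / 2 := by linarith only [hθ2]
  obtain ⟨hk1, -, -, hδ0, hδ, h243⟩ := leak_numerics hK hε hρ hlo k hk
  -- (1) part 66's rung, verbatim
  obtain ⟨T', θ₁, tz, r', θ', ⟨hrT, hτ, hτf, hcpos, hbT, hθ₁lo, hθ₁hi, hcT, hpin, he0, hecr⟩,
      ⟨htz1, hbz, htz2, hr'3, hcold, hcr'⟩, ⟨hbr', hθ'hi, hθ'lo, hP', hrr'⟩⟩ :=
    knob_rung_succ_fine hX h0 hC hK hε hεK hρ hlo hhi k hk hr hθ1 hθ2 hbr hcr hPr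
  have hpin' := hpin
  obtain ⟨δ, hδ_def⟩ :
      ∃ δ : ℝ, δ = k * π / ((25 / 16 - 1 / 10 ^ 6) * K ^ 10 - 1) + 1 / K ^ 19 := ⟨_, rfl⟩
  simp only [← hδ_def] at hδ0 hδ hpin hPr
  have hT'0 : 0 ≤ T' := by linarith only [hr, hrT]
  have hTr' : T' ≤ r' := by linarith only [htz1, htz2]
  have hx : 0 ≤ K * X T' 4 := mul_nonneg hK0.le he0
  -- (2) the exit clock and the kept ring at part 66's exit
  have hθ₁1 : 31 / 32 * θ ≤ θ₁ := by linarith only [hθ₁lo, hθ1, h243]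
  have hbT' : X T' 1 ≤ -(31 / 32 * θ * ε) := by
    rw [hbT]
    nlinarith only [hθ₁1, hε]
  have h1610 : (16 : ℝ) ^ 10 ≤ K ^ 10 := pow_le_pow_left₀ (by norm_num) hK 10
  have hρε2 : ρ ^ 2 ≤ 2 * ε / K ^ 10 := by
    rw [le_div_iff₀ hK10pos]
    linarith only [hhi]
  have hc1 : ρ ^ 2 / K ^ 9 ≤ ε / 10 ^ 3 := by
    have e1 : ρ ^ 2 / K ^ 9 ≤ ρ ^ 2 :=
      div_le_self (by positivity) (one_le_pow₀ (by linarith only [hK]))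
    have e3 : 2 * ε / K ^ 10 ≤ 2 * ε / 16 ^ 10 :=
      div_le_div_of_nonneg_left (by positivity) (by positivity) h1610
    have e4 : 2 * ε / 16 ^ 10 ≤ ε / 10 ^ 3 := by
      rw [div_le_div_iff₀ (by positivity) (by positivity)]
      linarith only [hε]
    linarith only [e1, hρε2, e3, e4]
  have hρε : ρ ^ 2 ≤ ε := by
    have e1 : 2 * ε / K ^ 10 ≤ 2 * ε / 16 ^ 10 :=
      div_le_div_of_nonneg_left (by positivity) (by positivity) h1610
    have e2 : 2 * ε / 16 ^ 10 ≤ ε := by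
      rw [div_le_iff₀ (by positivity)]
      linarith only [hε]
    linarith only [hρε2, e1, e2]
  have hc2 : (ρ ^ 2 / K ^ 9) ^ 2 ≤ ε ^ 2 / 10 ^ 6 := by
    calc (ρ ^ 2 / K ^ 9) ^ 2 ≤ (ε / 10 ^ 3) ^ 2 := pow_le_pow_left₀ (by positivity) hc1 2
      _ = ε ^ 2 / 10 ^ 6 := by rw [div_pow]; norm_num
  have hRs : X r 1 ^ 2 + X r 2 ^ 2 ≤ 4 * ε ^ 2 := by
    rw [hbr, hcr]
    have hθsq : θ ^ 2 ≤ (29 / 20) ^ 2 := pow_le_pow_left₀ (by linarith only [hθ1]) hθ2 2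
    have e1 : (θ * ε) ^ 2 ≤ (29 / 20) ^ 2 * ε ^ 2 := by
      rw [mul_pow]
      exact mul_le_mul_of_nonneg_right hθsq (sq_nonneg ε)
    nlinarith only [e1, hc2, sq_nonneg ε]
  have hkept := knob_radius_kept_free hX h0 (by positivity : (0 : ℝ) ≤ K ^ 10) hε hρε hK hr
    hτ hRs
  -- (3) the floor (part 71 §217, as in part 76 §227)
  have hbc : X r 1 ^ 2 + X r 2 ^ 2 ≤ (θ ^ 2 + 1 / 10 ^ 6) * ε ^ 2 := by
    rw [hbr, hcr]
    nlinarith only [hc2]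
  have hleak := knob_pulse_leak hX h0 hC hK hε hεK hρ hhi k hk hr hrT.le hτ
    (by linarith only [hθ1]) hbc hkept hpin
  have hPr0 : X r 3 ^ 2 + X r 4 ^ 2 ≤ 1 / 50 := by
    have : 0 ≤ 3 * (δ + 310 * log K / K ^ 9) / 10 + 6 / K ^ 9 :=
      add_nonneg (div_nonneg (mul_nonneg (by norm_num) (add_nonneg hδ0
        (div_nonneg (mul_nonneg (by norm_num) hlogK) hK9pos.le))) (by norm_num))
        (div_nonneg (by norm_num) hK9pos.le)
    linarith only [hPr, this]
  have hbc' : X r 1 ^ 2 + X r 2 ^ 2 ≤ 1 / 10 ^ 6 := by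
    refine hbc.trans ?_
    have e1 : (θ ^ 2 + 1 / 10 ^ 6) * ε ^ 2 ≤ (9 / 4 + 1 / 10 ^ 6) * ε ^ 2 :=
      mul_le_mul_of_nonneg_right (by nlinarith only [hθ1, hθ2]) (sq_nonneg ε)
    have hK20 : (2 : ℝ) ^ 80 ≤ K ^ 20 := by
      calc (2 : ℝ) ^ 80 = 16 ^ 20 := by norm_num
        _ ≤ K ^ 20 := pow_le_pow_left₀ (by norm_num) hK 20
    have e2 : ε ^ 2 ≤ 1 / (6 * 2 ^ 40) :=
      hεK.trans (div_le_div_of_nonneg_left (by norm_num) (by positivity)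
        (by linarith only [hK20]))
    nlinarith only [e1, e2]
  have hA : 49 / 50 - 1 / 10 ^ 6 ≤ X r 0 ^ 2 + X r 3 ^ 2 := by
    have hE := RotorKnob.traj_sum_sq_eq_one hX h0 r
    nlinarith only [hE, hbc', hPr0, sq_nonneg (X r 3)]
  have hnum : 1 / K ^ 9 ≤ ((X r 0 ^ 2 + X r 3 ^ 2) * π / 2 - δ - δ ^ 2) / ((θ + 1 / 500) * K ^ 9)
      - 1 / (600 * K ^ 9) := by
    have hpos : 0 < (θ + 1 / 500) * K ^ 9 := by positivity
    have hAπ : (49 / 50 - 1 / 10 ^ 6) * 3.14 ≤ (X r 0 ^ 2 + X r 3 ^ 2) * π :=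
      mul_le_mul hA Real.pi_gt_d2.le (by norm_num) (by positivity)
    have hδ2 : δ ^ 2 ≤ δ * (1 / 80) := by
      rw [sq]
      exact mul_le_mul_of_nonneg_left hδ hδ0
    have key : (1 + 1 / 600) * (θ + 1 / 500)
        ≤ (X r 0 ^ 2 + X r 3 ^ 2) * π / 2 - δ - δ ^ 2 := by
      nlinarith only [hAπ, hδ2, hδ, hδ0, hθ2, hθ1]
    have e1 : (1 + 1 / 600) / K ^ 9
        = (1 + 1 / 600) * (θ + 1 / 500) / ((θ + 1 / 500) * K ^ 9) := by
      rw [div_eq_div_iff hK9pos.ne' hpos.ne']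
      ring
    have e2 := div_le_div_of_nonneg_right key hpos.le
    rw [← e1] at e2
    have e3 : 1 / K ^ 9 = (1 + 1 / 600) / K ^ 9 - 1 / (600 * K ^ 9) := by
      rw [eq_sub_iff_add_eq, div_add_div _ _ hK9pos.ne' (by positivity),
        div_eq_div_iff (by positivity) hK9pos.ne']
      ring
    rw [e3]
    linarith only [e2]
  have hfloor : X r 4 + 1 / K ^ 9 ≤ X T' 4 := by linarith only [hleak, hnum]
  -- (4) the ceiling (part 75 §226) at the same pin; the pin term is tiny
  have hceil := knob_pulse_ceiling hX h0 hC hK hε hρ hlo hhi k hk hr hrT.le hτ hτf hθ1 hθ2'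
    hbr hcr hkept hcpos hbT' hpin
  have hδk : δ ≤ 4 * k / K ^ 10 := by
    rw [hδ_def]
    have e1 : k * π / ((25 / 16 - 1 / 10 ^ 6) * K ^ 10 - 1) ≤ k * π / (3 / 2 * K ^ 10) :=
      div_le_div_of_nonneg_left (by positivity) (by positivity) (by nlinarith only [h1610])
    have e2 : k * π / (3 / 2 * K ^ 10) ≤ 3 * k / K ^ 10 := by
      rw [div_le_div_iff₀ (by positivity) hK10pos]
      have hkK : (0 : ℝ) ≤ k * K ^ 10 := by positivity
      nlinarith only [mul_nonneg hkK (sub_nonneg.2 pi_le_four), hkK]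
    have e3 : 1 / K ^ 19 ≤ k / K ^ 10 := by
      calc 1 / K ^ 19 ≤ 1 / K ^ 10 := div_le_div_of_nonneg_left zero_le_one hK10pos
              (pow_le_pow_right₀ hK1 (by norm_num))
        _ ≤ k / K ^ 10 := div_le_div_of_nonneg_right hk1 hK10pos.le
    have e4 : 3 * (k : ℝ) / K ^ 10 + k / K ^ 10 = 4 * k / K ^ 10 := by ring
    linarith only [e1, e2, e3, e4]
  have hpinterm : 1500 * δ ^ 2 * log K ≤ k ^ 2 / 12 := by
    have e1 : δ ^ 2 ≤ (4 * k / K ^ 10) ^ 2 := pow_le_pow_left₀ hδ0 hδk 2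
    have e2 : log K ≤ K := (log_le_sub_one_of_pos hK0).trans (by linarith)
    have e3 : 1500 * δ ^ 2 * log K ≤ 1500 * (4 * k / K ^ 10) ^ 2 * K :=
      mul_le_mul (mul_le_mul_of_nonneg_left e1 (by norm_num)) e2 hlogK (by positivity)
    refine e3.trans ?_
    rw [show 1500 * (4 * (k : ℝ) / K ^ 10) ^ 2 * K = 24000 * k ^ 2 * K / (K ^ 10 * K ^ 10) by
        field_simp; ring, div_le_div_iff₀ (by positivity) (by norm_num)]
    have h19 : (16 : ℝ) ^ 19 ≤ K ^ 19 := pow_le_pow_left₀ (by norm_num) hK 19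
    nlinarith only [mul_le_mul_of_nonneg_left h19 (mul_nonneg hK0.le (sq_nonneg (k : ℝ))),
      sq_nonneg (k : ℝ), hK0]
  have hceil' : X T' 4
      ≤ X r 4 + (7 / 2 + k ^ 2 / 3 + (2 * log k + 520 * log K) * X r 3 ^ 2) / K ^ 9 := by
    have e : (7 / 2 + k ^ 2 / 4 + 2 * X r 3 ^ 2 * log k
        + (520 * X r 3 ^ 2 + 1500 * δ ^ 2) * log K) / K ^ 9
        ≤ (7 / 2 + k ^ 2 / 3 + (2 * log k + 520 * log K) * X r 3 ^ 2) / K ^ 9 :=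
      div_le_div_of_nonneg_right (by nlinarith only [hpinterm]) hK9pos.le
    linarith only [hceil, e]
  -- (5) the transfer mode across the pulse (part 79 §234 + §235)
  have hfine := knob_transfer_exit_fine hX h0 hC hK hε hρ hhi k hk hr hrT.le hτ hθ1 hθ2'
    hbr hcr hkept hcpos hbT' hpin
  have hnumL := ledger_numerics hK hεK hhi hk1 hδ0 hδk hx
  have hdT : |X T' 3| ≤ |X r 3| + (5 * k + (k / 2 + 4) * (K * X T' 4)) / K ^ 10 := by
    linarith only [hfine, hnumL]
  -- (6) the cold phase: duration, transfer damping (part 77 §229), output growth (§235)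
  have hdur : 9 / 4 ≤ r' - T' := by
    have hch := clock_charge_le hX h0 hε.le (by positivity : (0 : ℝ) ≤ K ^ 10) hTr'
    rw [hbr', hbT] at hch
    have hsum : 9 / 4 ≤ θ' + θ₁ := by
      have h286 : (286 : ℝ) / K ^ 9 ≤ 2 / 10 ^ 8 := by
        have e := div_le_div_of_nonneg_right (show (286 : ℝ) ≤ 2 * 243 by norm_num) hK9pos.le
        rw [mul_div_assoc] at e
        linarith only [e, h243]
      rcases hθ'lo with h | h <;> linarith only [h, hθ₁lo, hθ1, h243, h286]
    have h2 : ε * (9 / 4) ≤ ε * (r' - T') := by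
      have := mul_le_mul_of_nonneg_left hsum hε.le
      linarith only [this, hch]
    exact le_of_mul_le_mul_left h2 hε
  have hcoldT := knob_cold_transfer hX h0 hK hT'0 hTr' hr'3.le hcold hρ
  have hdcold : |X r' 3| ≤ |X T' 3| * exp (-(9 / 4 * (K * X T' 4))) + 3 / K ^ 9 := by
    have hexp : exp (-(K * X T' 4 * (r' - T'))) ≤ exp (-(9 / 4 * (K * X T' 4))) :=
      exp_le_exp.2 (by nlinarith only [hx, hdur])
    have := mul_le_mul_of_nonneg_left hexp (abs_nonneg (X T' 3))
    linarith only [hcoldT, this]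
  have hmono := RotorKnob.rotorCircuit_output_monotone hK0.le hX
  have hegrow := cold_output_growth hX h0 hK hT'0 hTr' hr'3.le hcold hρ
  exact ⟨T', θ₁, tz, r', θ', ⟨hrT, hτ, hτf, hcpos, hbT, hθ₁lo, hθ₁hi, hcT, hpin', he0, hecr⟩,
    ⟨htz1, hbz, htz2, hr'3, hcold, hcr'⟩, ⟨hbr', hθ'hi, hθ'lo, hP', hrr'⟩,
    ⟨hfloor, hceil', hdT, hdur, hdcold, hmono hTr', hegrow⟩⟩

end Summit.NavierStokesRegularity.FluidComputer.GateBudget
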